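import Mathlib
import HarnessLib
import Literature.Analysis.Calculus.LineRestrictionIteratedDeriv

/-!
# Route `KLProgramme` — engine support, route (L2′) layer (b), calculus core: FIRST and SECOND derivatives of a cutoff profile
# composed with a rescaled `C²` function along a line — the anisotropic first-order term kept explicit

HOME/prover-p4/FRAME-L22-NOTE.md §3′: on an admissible frame only `C²` data of the band `e_K` are uniform, and the `ℓ²` route needs exactly the
first two derivatives of the sampled multiplier symbol `s ↦ χ(λ·e(q + s w))` (`λ = γ^{-h} = 4ⁿ` the rescaling, `χ` a fixed smooth profile)
along lattice lines — with the FIRST-order term in the anisotropic form `λ·|De(q + s w)·w|` (small along the tangent of the Fermi curve, where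
`De·w` is small on the sector box), not the isotropic `λ‖De‖‖w‖`.  Pure one-variable calculus, then the line instance:

* `deriv_comp_const_mul`, `iteratedDeriv_two_comp_const_mul` — `(χ(λg))′ = χ′(λg)·λg′`, `(χ(λg))″ = χ″(λg)(λg′)² + χ′(λg)·λg″` for `C²` `χ, g`;
* `abs_deriv_comp_const_mul_le`, `abs_iteratedDeriv_two_comp_const_mul_le` — `|·| ≤ c₁λ|g′|`, `≤ c₂λ²g′² + c₁λ|g″|` from profile bounds
  `|χ′| ≤ c₁`, `|χ″| ≤ c₂`;
* `abs_deriv_sub_deriv_le_of_iteratedDeriv_two` — `|g′(s) − g′(s₀)| ≤ G₂|s − s₀|` when `|g″| ≤ G₂` (so `g′` stays small on a box where it is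
  small at the centre);
* line instance (`g s = e(q + s•w)`, `e : V → ℝ` of class `C²` with `‖D²e‖ ≤ K₂`): `deriv_line_eq_fderiv`, `abs_iteratedDeriv_two_line_le`
  (`|g″| ≤ K₂‖w‖²`), **`abs_deriv_cutoff_line_le`** / **`abs_iteratedDeriv_two_cutoff_line_le`**:
  `|∂_s χ(λe(q+sw))| ≤ c₁λ|De(q+sw)w|`, `|∂_s² χ(λe(q+sw))| ≤ c₂λ²(De(q+sw)w)² + c₁λK₂‖w‖²`, and
  **`abs_fderiv_line_le`**: `|De(q+sw)w| ≤ |De(q)w| + K₂‖w‖²|s|`.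

Everything is proved; no definitions, no named facts. [folklore]
-/

noncomputable section

namespace Summit.HubbardSuperconductivity.HubbardSuperconductivity.Theorems.TorusFourierL2

set_option linter.dupNamespace false -- summit = problem name (single-conjunct summit), D-0017

open Literature.Analysis.Calculus

/-! ### One-variable composition with a rescaling -/

/-- `deriv χ` is differentiable with derivative `iteratedDeriv 2 χ` (for `χ ∈ C²`). [folklore] -/
theorem hasDerivAt_deriv_of_contDiff_two {χ : ℝ → ℝ} (hχ : ContDiff ℝ 2 χ) (y : ℝ) :
    HasDerivAt (deriv χ) (iteratedDeriv 2 χ y) y := by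
  have hd : Differentiable ℝ (iteratedDeriv 1 χ) := hχ.differentiable_iteratedDeriv 1 (by norm_num)
  rw [iteratedDeriv_one] at hd
  have h := (hd y).hasDerivAt
  rwa [← iteratedDeriv_one (f := χ), ← iteratedDeriv_succ, iteratedDeriv_one] at h

/-- **Chain rule with a rescaling**: `HasDerivAt (s ↦ χ(λ·g s)) (χ′(λ g s)·(λ·g′ s)) s`. [folklore] -/
theorem hasDerivAt_comp_const_mul {χ g : ℝ → ℝ} (hχ : ContDiff ℝ 2 χ) (hg : ContDiff ℝ 2 g) (lam s : ℝ) :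
    HasDerivAt (fun s => χ (lam * g s)) (deriv χ (lam * g s) * (lam * deriv g s)) s := by
  have h2ne : (2 : WithTop ℕ∞) ≠ 0 := by norm_num
  have hg1 : HasDerivAt (fun s => lam * g s) (lam * deriv g s) s := ((hg.differentiable h2ne) s).hasDerivAt.const_mul lam
  have hχ1 : HasDerivAt χ (deriv χ (lam * g s)) (lam * g s) := ((hχ.differentiable h2ne) _).hasDerivAt
  exact hχ1.comp s hg1

/-- `(χ(λg))′ = χ′(λg)·λ g′`. [folklore] -/
theorem deriv_comp_const_mul {χ g : ℝ → ℝ} (hχ : ContDiff ℝ 2 χ) (hg : ContDiff ℝ 2 g) (lam : ℝ) :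
    deriv (fun s => χ (lam * g s)) = fun s => deriv χ (lam * g s) * (lam * deriv g s) :=
  funext fun s => (hasDerivAt_comp_const_mul hχ hg lam s).deriv

/-- **Second derivative of the composition**: `(χ(λg))″(s) = χ″(λ g s)·(λ g′ s)² + χ′(λ g s)·(λ g″ s)`. [folklore] -/
theorem iteratedDeriv_two_comp_const_mul {χ g : ℝ → ℝ} (hχ : ContDiff ℝ 2 χ) (hg : ContDiff ℝ 2 g) (lam s : ℝ) :
    iteratedDeriv 2 (fun s => χ (lam * g s)) s =
      iteratedDeriv 2 χ (lam * g s) * (lam * deriv g s) ^ 2 + deriv χ (lam * g s) * (lam * iteratedDeriv 2 g s) := by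
  have h2ne : (2 : WithTop ℕ∞) ≠ 0 := by norm_num
  rw [iteratedDeriv_succ, iteratedDeriv_one, deriv_comp_const_mul hχ hg lam]
  have hg1 : HasDerivAt (fun s => lam * g s) (lam * deriv g s) s := ((hg.differentiable h2ne) s).hasDerivAt.const_mul lam
  have hA : HasDerivAt (fun s => deriv χ (lam * g s)) (iteratedDeriv 2 χ (lam * g s) * (lam * deriv g s)) s := by
    have h := (hasDerivAt_deriv_of_contDiff_two hχ (lam * g s)).comp s hg1
    exact h
  have hB : HasDerivAt (fun s => lam * deriv g s) (lam * iteratedDeriv 2 g s) s :=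
    (hasDerivAt_deriv_of_contDiff_two hg s).const_mul lam
  have hAB : HasDerivAt (fun s => deriv χ (lam * g s) * (lam * deriv g s))
      (iteratedDeriv 2 χ (lam * g s) * (lam * deriv g s) * (lam * deriv g s) +
        deriv χ (lam * g s) * (lam * iteratedDeriv 2 g s)) s := hA.mul hB
  rw [hAB.deriv]
  ring

/-- **First-order bound**: `|(χ(λg))′(s)| ≤ c₁·|λ|·|g′(s)|` when `|χ′| ≤ c₁`. [folklore] -/
theorem abs_deriv_comp_const_mul_le {χ g : ℝ → ℝ} (hχ : ContDiff ℝ 2 χ) (hg : ContDiff ℝ 2 g) (lam : ℝ) {c₁ : ℝ}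
    (h1 : ∀ y, |deriv χ y| ≤ c₁) (s : ℝ) :
    |deriv (fun s => χ (lam * g s)) s| ≤ c₁ * |lam| * |deriv g s| := by
  rw [deriv_comp_const_mul hχ hg lam, abs_mul, abs_mul]
  have := h1 (lam * g s)
  have h0 : 0 ≤ |lam| * |deriv g s| := by positivity
  nlinarith

/-- **Second-order bound**: `|(χ(λg))″(s)| ≤ c₂λ²g′(s)² + c₁|λ||g″(s)|` when `|χ′| ≤ c₁`, `|χ″| ≤ c₂`. [folklore] -/
theorem abs_iteratedDeriv_two_comp_const_mul_le {χ g : ℝ → ℝ} (hχ : ContDiff ℝ 2 χ) (hg : ContDiff ℝ 2 g) (lam : ℝ)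
    {c₁ c₂ : ℝ} (h1 : ∀ y, |deriv χ y| ≤ c₁) (h2 : ∀ y, |iteratedDeriv 2 χ y| ≤ c₂) (s : ℝ) :
    |iteratedDeriv 2 (fun s => χ (lam * g s)) s| ≤ c₂ * (lam * deriv g s) ^ 2 + c₁ * |lam| * |iteratedDeriv 2 g s| := by
  rw [iteratedDeriv_two_comp_const_mul hχ hg lam s]
  have hA : |iteratedDeriv 2 χ (lam * g s) * (lam * deriv g s) ^ 2| ≤ c₂ * (lam * deriv g s) ^ 2 := by
    rw [abs_mul, abs_pow, sq_abs]
    exact mul_le_mul_of_nonneg_right (h2 _) (sq_nonneg _)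
  have hB : |deriv χ (lam * g s) * (lam * iteratedDeriv 2 g s)| ≤ c₁ * |lam| * |iteratedDeriv 2 g s| := by
    rw [abs_mul, abs_mul, ← mul_assoc]
    exact mul_le_mul_of_nonneg_right (mul_le_mul_of_nonneg_right (h1 _) (abs_nonneg _)) (abs_nonneg _)
  exact (abs_add_le _ _).trans (add_le_add hA hB)

/-- **The first derivative drifts at most linearly**: `|g′(s) − g′(s₀)| ≤ G₂·|s − s₀|` when `|g″| ≤ G₂` everywhere. [folklore] -/
theorem abs_deriv_sub_deriv_le_of_iteratedDeriv_two {g : ℝ → ℝ} (hg : ContDiff ℝ 2 g) {G₂ : ℝ}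
    (hG : ∀ s, |iteratedDeriv 2 g s| ≤ G₂) (s s₀ : ℝ) :
    |deriv g s - deriv g s₀| ≤ G₂ * |s - s₀| := by
  have hd : ∀ x, HasDerivAt (deriv g) (iteratedDeriv 2 g x) x := fun x => hasDerivAt_deriv_of_contDiff_two hg x
  have hdiff : Differentiable ℝ (deriv g) := fun x => (hd x).differentiableAt
  have hbound : ∀ x, ‖deriv (deriv g) x‖ ≤ G₂ := fun x => by
    rw [(hd x).deriv, Real.norm_eq_abs]; exact hG x
  have h := Convex.norm_image_sub_le_of_norm_deriv_le (fun x _ => hdiff x) (fun x _ => hbound x) convex_univ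
    (Set.mem_univ s₀) (Set.mem_univ s)
  rw [Real.norm_eq_abs, Real.norm_eq_abs] at h
  exact h

/-! ### The line instance -/

section Line

variable {V : Type*} [NormedAddCommGroup V] [NormedSpace ℝ V]

/-- The restriction to a line is `C²`. [folklore] -/
theorem contDiff_two_line {e : V → ℝ} (he : ContDiff ℝ 2 e) (q w : V) : ContDiff ℝ 2 fun s : ℝ => e (q + s • w) :=
  contDiff_lineRestriction he q w

/-- **The first derivative along the line is the Fréchet derivative on the direction**: `g′(s) = De(q + s w)·w`. [folklore] -/
theorem deriv_line_eq_fderiv {e : V → ℝ} (he : ContDiff ℝ 2 e) (q w : V) (s : ℝ) :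
    deriv (fun s : ℝ => e (q + s • w)) s = fderiv ℝ e (q + s • w) w := by
  have h := iteratedDeriv_lineRestriction (n := 1) (he.of_le (by norm_num)) q w s
  rw [iteratedDeriv_one] at h
  rw [h, iteratedFDeriv_one_apply]

/-- **The second derivative along the line** is bounded by `K₂‖w‖²`. [folklore] -/
theorem abs_iteratedDeriv_two_line_le {e : V → ℝ} (he : ContDiff ℝ 2 e) {K₂ : ℝ} (hK₂ : ∀ p, ‖iteratedFDeriv ℝ 2 e p‖ ≤ K₂)
    (q w : V) (s : ℝ) : |iteratedDeriv 2 (fun s : ℝ => e (q + s • w)) s| ≤ K₂ * ‖w‖ ^ 2 := by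
  have h := norm_iteratedDeriv_lineRestriction_le_of_le (n := 2) he hK₂ q w s
  rwa [Real.norm_eq_abs] at h

/-- **The directional derivative drifts at most linearly along the line**: `|De(q + s w)w − De(q)w| ≤ K₂‖w‖²|s|`. [folklore] -/
theorem abs_fderiv_line_sub_le {e : V → ℝ} (he : ContDiff ℝ 2 e) {K₂ : ℝ} (hK₂ : ∀ p, ‖iteratedFDeriv ℝ 2 e p‖ ≤ K₂)
    (q w : V) (s : ℝ) : |fderiv ℝ e (q + s • w) w - fderiv ℝ e q w| ≤ K₂ * ‖w‖ ^ 2 * |s| := by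
  have h := abs_deriv_sub_deriv_le_of_iteratedDeriv_two (contDiff_two_line he q w)
    (fun s => abs_iteratedDeriv_two_line_le he hK₂ q w s) s 0
  rw [deriv_line_eq_fderiv he q w s, deriv_line_eq_fderiv he q w 0, zero_smul, add_zero, sub_zero] at h
  exact h

/-- `|De(q + s w)w| ≤ |De(q)w| + K₂‖w‖²|s|` — the directional derivative stays small on a box where it is small at the centre. [folklore] -/
theorem abs_fderiv_line_le {e : V → ℝ} (he : ContDiff ℝ 2 e) {K₂ : ℝ} (hK₂ : ∀ p, ‖iteratedFDeriv ℝ 2 e p‖ ≤ K₂)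
    (q w : V) (s : ℝ) : |fderiv ℝ e (q + s • w) w| ≤ |fderiv ℝ e q w| + K₂ * ‖w‖ ^ 2 * |s| := by
  have h := abs_fderiv_line_sub_le he hK₂ q w s
  have := abs_sub_abs_le_abs_sub (fderiv ℝ e (q + s • w) w) (fderiv ℝ e q w)
  linarith

/-- **First derivative of the rescaled cutoff along a line**: `|∂_s χ(λ·e(q + s w))| ≤ c₁|λ|·|De(q + s w)w|`. [folklore] -/
theorem abs_deriv_cutoff_line_le {e : V → ℝ} (he : ContDiff ℝ 2 e) {χ : ℝ → ℝ} (hχ : ContDiff ℝ 2 χ) (lam : ℝ) {c₁ : ℝ}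
    (h1 : ∀ y, |deriv χ y| ≤ c₁) (q w : V) (s : ℝ) :
    |deriv (fun s : ℝ => χ (lam * e (q + s • w))) s| ≤ c₁ * |lam| * |fderiv ℝ e (q + s • w) w| := by
  have h := abs_deriv_comp_const_mul_le hχ (contDiff_two_line he q w) lam h1 s
  rwa [deriv_line_eq_fderiv he q w s] at h

/-- **Second derivative of the rescaled cutoff along a line**:
`|∂_s² χ(λ·e(q + s w))| ≤ c₂λ²(De(q + s w)w)² + c₁|λ|K₂‖w‖²` — only `C²` data of `e`. [folklore] -/
theorem abs_iteratedDeriv_two_cutoff_line_le {e : V → ℝ} (he : ContDiff ℝ 2 e) {K₂ : ℝ}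
    (hK₂ : ∀ p, ‖iteratedFDeriv ℝ 2 e p‖ ≤ K₂) {χ : ℝ → ℝ} (hχ : ContDiff ℝ 2 χ) (lam : ℝ) {c₁ c₂ : ℝ} (hc₁ : 0 ≤ c₁)
    (h1 : ∀ y, |deriv χ y| ≤ c₁) (h2 : ∀ y, |iteratedDeriv 2 χ y| ≤ c₂) (q w : V) (s : ℝ) :
    |iteratedDeriv 2 (fun s : ℝ => χ (lam * e (q + s • w))) s| ≤
      c₂ * (lam * fderiv ℝ e (q + s • w) w) ^ 2 + c₁ * |lam| * (K₂ * ‖w‖ ^ 2) := by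
  have h := abs_iteratedDeriv_two_comp_const_mul_le hχ (contDiff_two_line he q w) lam h1 h2 s
  rw [deriv_line_eq_fderiv he q w s] at h
  have hg2 := abs_iteratedDeriv_two_line_le he hK₂ q w s
  have hmono : c₁ * |lam| * |iteratedDeriv 2 (fun s : ℝ => e (q + s • w)) s| ≤ c₁ * |lam| * (K₂ * ‖w‖ ^ 2) :=
    mul_le_mul_of_nonneg_left hg2 (by positivity)
  linarith

/-- **Anisotropic form on the sector box**: if at the centre `q_F` the direction `w` is nearly tangent, `|De(q_F)w| ≤ τ`, then at every point
`q_F + s w` of the segment `|s| ≤ σ`: `|∂_s χ(λe)| ≤ c₁|λ|(τ + K₂‖w‖²σ)` and `|∂_s² χ(λe)| ≤ c₂λ²(τ + K₂‖w‖²σ)² + c₁|λ|K₂‖w‖²`. [folklore] -/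
theorem abs_derivs_cutoff_line_le_of_center {e : V → ℝ} (he : ContDiff ℝ 2 e) {K₂ : ℝ}
    (hK₂ : ∀ p, ‖iteratedFDeriv ℝ 2 e p‖ ≤ K₂) {χ : ℝ → ℝ} (hχ : ContDiff ℝ 2 χ) (lam : ℝ) {c₁ c₂ : ℝ} (hc₁ : 0 ≤ c₁)
    (hc₂ : 0 ≤ c₂) (h1 : ∀ y, |deriv χ y| ≤ c₁) (h2 : ∀ y, |iteratedDeriv 2 χ y| ≤ c₂) (q w : V) {τ σ s : ℝ}
    (hτ : |fderiv ℝ e q w| ≤ τ) (hs : |s| ≤ σ) :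
    |deriv (fun s : ℝ => χ (lam * e (q + s • w))) s| ≤ c₁ * |lam| * (τ + K₂ * ‖w‖ ^ 2 * σ) ∧
      |iteratedDeriv 2 (fun s : ℝ => χ (lam * e (q + s • w))) s| ≤
        c₂ * lam ^ 2 * (τ + K₂ * ‖w‖ ^ 2 * σ) ^ 2 + c₁ * |lam| * (K₂ * ‖w‖ ^ 2) := by
  have hK0 : 0 ≤ K₂ := le_trans (norm_nonneg _) (hK₂ q)
  have hdir : |fderiv ℝ e (q + s • w) w| ≤ τ + K₂ * ‖w‖ ^ 2 * σ := by
    have h := abs_fderiv_line_le he hK₂ q w s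
    have : K₂ * ‖w‖ ^ 2 * |s| ≤ K₂ * ‖w‖ ^ 2 * σ := mul_le_mul_of_nonneg_left hs (by positivity)
    linarith
  have hτ0 : 0 ≤ τ + K₂ * ‖w‖ ^ 2 * σ := le_trans (abs_nonneg _) hdir
  refine ⟨(abs_deriv_cutoff_line_le he hχ lam h1 q w s).trans (mul_le_mul_of_nonneg_left hdir (by positivity)), ?_⟩
  have h := abs_iteratedDeriv_two_cutoff_line_le he hK₂ hχ lam hc₁ h1 h2 q w s
  have hsq : (lam * fderiv ℝ e (q + s • w) w) ^ 2 ≤ lam ^ 2 * (τ + K₂ * ‖w‖ ^ 2 * σ) ^ 2 := by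
    rw [mul_pow]
    refine mul_le_mul_of_nonneg_left ?_ (sq_nonneg _)
    have hle : (fderiv ℝ e (q + s • w) w) ^ 2 = |fderiv ℝ e (q + s • w) w| ^ 2 := (sq_abs _).symm
    rw [hle]
    exact pow_le_pow_left₀ (abs_nonneg _) hdir 2
  nlinarith [mul_le_mul_of_nonneg_left hsq hc₂]

end Line

end Summit.HubbardSuperconductivity.HubbardSuperconductivity.Theorems.TorusFourierL2

end
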